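import Mathlib.Topology.Connected.LocallyConnected
import Mathlib.Topology.Compactness.LocallyCompact
import Mathlib.Topology.Separation.Hausdorff
import HarnessLib

/-!
# Filling the relatively compact holes of a compact set (Phillips 1967, proof of Lemma 1.1)

Topic `Literature/Topology`; general topology infrastructure for the handle decomposition of open
manifolds (Phillips 1967, Lemma 1.1, first paragraph of the proof):

> *"First realize `M` as `⋃ Mᵢ`, an expanding union of compact manifolds with smooth boundary,
> such that `Mᵢ ⊂ Int Mᵢ₊₁`. Next let `Mᵢ'` be the union of `Mᵢ` and of the compact components
> of `M - Int Mᵢ`. Then `M = ⋃ Mᵢ'` is again an expanding union of compact manifolds with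
> boundary … if `A` is a compact component of `M - Int Mᵢ'` …"*

The point of the passage is that `Mᵢ'` is again **compact** and that the complement of `Mᵢ'`
has **no compact (relatively compact) component**, which is what makes the triads
`(Mᵢ₊₁' - Int Mᵢ'; ∂Mᵢ', ∂Mᵢ₊₁')` satisfy `H₀(Mᵢ₊₁' - Int Mᵢ', ∂Mᵢ₊₁') = 0`. Both use that `M`
is *open*, i.e. has no compact component. We prove the underlying point-set statement, for a
Hausdorff, weakly locally compact, locally connected space `X` none of whose connected components
is compact (e.g. an open manifold):

* `Literature.Topology.exists_isCompact_superset_forall_not_isCompact_closure` — every compact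
  `K ⊆ X` lies in a compact `K'` such that no connected component of `X ∖ K'` has compact
  closure; namely `K' = K ∪ ⋃ {C | C` a component of `X ∖ K` with compact closure`}`.

Proof. `K'` is closed: its complement is the union of the remaining (open) components of
`X ∖ K`. `K'` is contained in a compact set: choose a compact `L` with `K ⊆ interior L`; a
component `C` of `X ∖ K` either meets the compact set `frontier L ⊆ X ∖ K` — finitely many do,
the components being open and disjoint — or lies in `interior L`, or lies in `(closure L)ᶜ`; in
the last case `closure C` misses `K`, so `C` is closed (a component of `X ∖ K` is relatively
closed), open and, if relatively compact, compact, hence contains the (then compact) component of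
any of its points — excluded. The components of `X ∖ K'` are exactly the components of `X ∖ K`
without compact closure.

## References

* A. Phillips, *Submersions of open manifolds*, Topology **6** (1967), 171–206, proof of
  Lemma 1.1 (p. 176). [Phillips1967]
-/

open Set Topology

namespace Literature.Topology

variable {X : Type*} [TopologicalSpace X]

/-- A connected component of `F` whose closure lies in `F` is closed: the closure is
preconnected, lies in `F` and contains the component, hence equals it by maximality. [folklore] -/
theorem isClosed_connectedComponentIn_of_closure_subset {F : Set X} {x : X}
    (h : closure (connectedComponentIn F x) ⊆ F) : IsClosed (connectedComponentIn F x) := by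
  by_cases hx : x ∈ F
  · refine isClosed_of_closure_subset ?_
    exact isPreconnected_connectedComponentIn.closure.subset_connectedComponentIn
      (subset_closure (mem_connectedComponentIn hx)) h
  · rw [connectedComponentIn_eq_empty hx]
    exact isClosed_empty

/-- **Filling the relatively compact holes of a compact set** (Phillips 1967, proof of
Lemma 1.1: "let `Mᵢ'` be the union of `Mᵢ` and of the compact components of `M - Int Mᵢ`").
Let `X` be Hausdorff, weakly locally compact and locally connected, with no compact connected
component (an *open* manifold). Then every compact `K ⊆ X` is contained in a compact `K'` such
that no connected component of `X ∖ K'` has compact closure.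
[cite: Phillips1967, proof of Lemma 1.1 (p. 176)] -/
theorem exists_isCompact_superset_forall_not_isCompact_closure [T2Space X]
    [WeaklyLocallyCompactSpace X] [LocallyConnectedSpace X]
    (hopen : ∀ x : X, ¬ IsCompact (connectedComponent x)) {K : Set X} (hK : IsCompact K) :
    ∃ K' : Set X, IsCompact K' ∧ K ⊆ K' ∧
      ∀ x, x ∉ K' → ¬ IsCompact (closure (connectedComponentIn K'ᶜ x)) := by
  classical
  -- the components of `X ∖ K`, the relatively compact ones, and the filled set `K'`
  set C : X → Set X := fun x => connectedComponentIn Kᶜ x with hC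
  set B : Set X := ⋃ x ∈ {x | x ∉ K ∧ IsCompact (closure (C x))}, C x with hB
  set K' : Set X := K ∪ B with hK'
  have hCo : ∀ x, IsOpen (C x) := fun x => hK.isClosed.isOpen_compl.connectedComponentIn
  have hCeq : ∀ {a b : X}, b ∈ C a → C a = C b := fun h => connectedComponentIn_eq h
  have hCK : ∀ x, C x ⊆ Kᶜ := fun x => connectedComponentIn_subset _ _
  -- membership in `B` is a property of the component
  have hmemB : ∀ {x y : X}, y ∈ C x → (y ∈ B ↔ IsCompact (closure (C x))) := by
    intro x y hy
    have hCy : C y = C x := (hCeq hy).symm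
    constructor
    · intro hyB
      simp only [hB, mem_iUnion, mem_setOf_eq, exists_prop] at hyB
      obtain ⟨z, ⟨-, hz⟩, hyz⟩ := hyB
      rwa [hCeq hyz, hCy] at hz
    · intro hc
      simp only [hB, mem_iUnion, mem_setOf_eq, exists_prop]
      exact ⟨y, ⟨hCK x hy, by rwa [hCy]⟩, by rw [hCy]; exact hy⟩
  -- a relatively compact component of `X ∖ K` cannot be closed in `X`
  have hnotclosed : ∀ x, x ∉ K → IsCompact (closure (C x)) → ¬ IsClosed (C x) := by
    intro x hx hc hcl
    have hclopen : IsClopen (C x) := ⟨hcl, hCo x⟩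
    have hsub : connectedComponent x ⊆ C x :=
      hclopen.connectedComponent_subset (mem_connectedComponentIn hx)
    refine hopen x (hc.of_isClosed_subset isClosed_connectedComponent ?_)
    exact hsub.trans subset_closure
  -- `K'` is closed: its complement is a union of open components
  have hK'c : K'ᶜ = ⋃ x ∈ {x | x ∉ K ∧ ¬ IsCompact (closure (C x))}, C x := by
    ext y
    simp only [hK', mem_compl_iff, mem_union, not_or, mem_iUnion, mem_setOf_eq, exists_prop]
    constructor
    · rintro ⟨hyK, hyB⟩
      refine ⟨y, ⟨hyK, fun hc => hyB ((hmemB (mem_connectedComponentIn hyK)).2 hc)⟩,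
        mem_connectedComponentIn hyK⟩
    · rintro ⟨x, ⟨-, hx⟩, hyx⟩
      exact ⟨hCK x hyx, fun hyB => hx ((hmemB hyx).1 hyB)⟩
  have hK'closed : IsClosed K' := by
    rw [← isOpen_compl_iff, hK'c]
    exact isOpen_biUnion fun x _ => hCo x
  -- `K'` lies in a compact set
  obtain ⟨L, hL, hKL⟩ := exists_compact_superset hK
  have hfrK : frontier L ⊆ Kᶜ := fun y hy hyK => hy.2 (hKL hyK)
  have hfrc : IsCompact (frontier L) :=
    hL.of_isClosed_subset isClosed_frontier
      (frontier_subset_closure.trans hL.isClosed.closure_subset)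
  obtain ⟨t, htcov⟩ : ∃ t : Finset X, frontier L ⊆ ⋃ x ∈ t, C x :=
    hfrc.elim_finite_subcover (fun x => C x) (fun x => hCo x) fun y hy =>
      mem_iUnion.2 ⟨y, mem_connectedComponentIn (hfrK hy)⟩
  have hBsub : B ⊆ L ∪ ⋃ x ∈ (t.filter fun x => IsCompact (closure (C x))), closure (C x) := by
    intro y hyB
    simp only [hB, mem_iUnion, mem_setOf_eq, exists_prop] at hyB
    obtain ⟨z, ⟨hzK, hzc⟩, hyz⟩ := hyB
    by_cases hmeet : (C z ∩ frontier L).Nonempty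
    · obtain ⟨w, hwC, hwfr⟩ := hmeet
      obtain ⟨x, hxt, hwx⟩ := mem_iUnion₂.1 (htcov hwfr)
      have hCx : C x = C z := by rw [hCeq hwx, ← hCeq hwC]
      refine Or.inr (mem_iUnion₂.2 ⟨x, ?_, ?_⟩)
      · rw [Finset.mem_filter]; exact ⟨hxt, by rw [hCx]; exact hzc⟩
      · rw [hCx]; exact subset_closure hyz
    · -- `C z` misses the frontier of `L`: it lies inside or outside `L`
      rw [not_nonempty_iff_eq_empty] at hmeet
      have hsplit : C z ⊆ interior L ∪ (closure L)ᶜ := by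
        intro w hw
        by_contra hw'
        simp only [mem_union, mem_compl_iff, not_or, not_not] at hw'
        have : w ∈ C z ∩ frontier L := ⟨hw, hw'.2, hw'.1⟩
        rw [hmeet] at this
        exact this
      rcases isPreconnected_connectedComponentIn.subset_or_subset isOpen_interior
        isClosed_closure.isOpen_compl (disjoint_compl_right.mono_left interior_subset_closure)
        hsplit with h | h
      · exact Or.inl (interior_subset (h hyz))
      · -- outside: `closure (C z)` misses `K`, so `C z` is closed — impossible
        exfalso
        refine hnotclosed z hzK hzc (isClosed_connectedComponentIn_of_closure_subset ?_)
        intro w hw hwK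
        have h1 : closure (C z) ⊆ closure ((closure L)ᶜ) := closure_mono h
        have h2 : closure ((closure L)ᶜ) ⊆ (interior L)ᶜ := by
          rw [closure_compl]
          exact compl_subset_compl.2 (interior_mono subset_closure)
        exact (h2 (h1 hw)) (hKL hwK)
  have hK'cpt : IsCompact K' := by
    refine (hL.union ((t.filter fun x => IsCompact (closure (C x))).isCompact_biUnion
      fun x hx => (Finset.mem_filter.1 hx).2)).of_isClosed_subset hK'closed ?_
    exact union_subset ((hKL.trans interior_subset).trans subset_union_left) hBsub
  refine ⟨K', hK'cpt, subset_union_left, fun x hx hc => ?_⟩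
  -- the component of `x ∉ K'` in `X ∖ K'` is its component in `X ∖ K`, not relatively compact
  have hxK : x ∉ K := fun h => hx (Or.inl h)
  have hxB : x ∉ B := fun h => hx (Or.inr h)
  have hnc : ¬ IsCompact (closure (C x)) := fun h =>
    hxB ((hmemB (mem_connectedComponentIn hxK)).2 h)
  have heq : connectedComponentIn K'ᶜ x = C x := by
    refine (connectedComponentIn_mono x (compl_subset_compl.2 subset_union_left)).antisymm ?_
    refine isPreconnected_connectedComponentIn.subset_connectedComponentIn
      (mem_connectedComponentIn hxK) fun y hy hyK' => ?_
    rcases hyK' with hyK | hyB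
    · exact hCK x hy hyK
    · exact hnc ((hmemB hy).1 hyB)
  exact hnc (heq ▸ hc)


/-- **Exhaustion without relatively compact holes** (Phillips 1967, proof of Lemma 1.1: "Then
`M = ⋃ Mᵢ'` is again an expanding union of compact [sets] … and `Mᵢ' ⊂ Int Mᵢ₊₁'`", no
component of `M - Mᵢ'` being relatively compact). A σ-compact, Hausdorff, weakly locally
compact, locally connected space without compact components admits a compact exhaustion
`K 0 ⊆ interior (K 1) ⊆ K 1 ⊆ ⋯`, `⋃ K n = X`, such that for every `n` no connected component of
`X ∖ K n` has compact closure. [cite: Phillips1967, proof of Lemma 1.1 (p. 176)] -/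
theorem exists_exhaustion_forall_not_isCompact_closure [T2Space X] [WeaklyLocallyCompactSpace X]
    [LocallyConnectedSpace X] [SigmaCompactSpace X]
    (hopen : ∀ x : X, ¬ IsCompact (connectedComponent x)) :
    ∃ K : ℕ → Set X, (∀ n, IsCompact (K n)) ∧ (∀ n, K n ⊆ interior (K (n + 1))) ∧
      (⋃ n, K n) = univ ∧
      ∀ n x, x ∉ K n → ¬ IsCompact (closure (connectedComponentIn (K n)ᶜ x)) := by
  classical
  set E : CompactExhaustion X := CompactExhaustion.choice X with hE
  -- one step: a compact set with the required property containing a given compact set in its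
  -- interior
  have hstep : ∀ A : Set X, IsCompact A → ∃ A' : Set X, IsCompact A' ∧ A ⊆ interior A' ∧
      ∀ x, x ∉ A' → ¬ IsCompact (closure (connectedComponentIn A'ᶜ x)) := by
    intro A hA
    obtain ⟨L, hL, hAL⟩ := exists_compact_superset hA
    obtain ⟨A', hA', hLA', hcomp⟩ :=
      exists_isCompact_superset_forall_not_isCompact_closure hopen hL
    exact ⟨A', hA', hAL.trans (interior_mono hLA'), hcomp⟩
  choose F hFc hFint hFcomp using hstep
  -- the exhaustion: `K 0 = F (E 0)`, `K (n + 1) = F (K n ∪ E (n + 1))`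
  let K : ℕ → {A : Set X // IsCompact A} := fun n =>
    Nat.rec ⟨F (E 0) (E.isCompact 0), hFc _ _⟩
      (fun n A => ⟨F (A.1 ∪ E (n + 1)) (A.2.union (E.isCompact (n + 1))), hFc _ _⟩) n
  have hK_succ : ∀ n, (K (n + 1)).1 =
      F ((K n).1 ∪ E (n + 1)) ((K n).2.union (E.isCompact (n + 1))) := fun n => rfl
  have hEK : ∀ n, E n ⊆ (K n).1 := by
    intro n
    cases n with
    | zero => exact (hFint _ _).trans interior_subset
    | succ n =>
      rw [hK_succ]
      exact subset_union_right.trans ((hFint _ _).trans interior_subset)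
  refine ⟨fun n => (K n).1, fun n => (K n).2, fun n => ?_, ?_, fun n x hx => ?_⟩
  · show (K n).1 ⊆ interior (K (n + 1)).1
    rw [hK_succ]
    exact subset_union_left.trans (hFint _ _)
  · exact eq_univ_of_forall fun x => by
      obtain ⟨n, hn⟩ := E.exists_mem x
      exact mem_iUnion.2 ⟨n, hEK n hn⟩
  · change x ∉ (K n).1 at hx
    show ¬ IsCompact (closure (connectedComponentIn ((K n).1)ᶜ x))
    cases n with
    | zero => exact hFcomp _ _ x hx
    | succ n =>
      rw [hK_succ] at hx ⊢
      exact hFcomp _ _ x hx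


/-! ### The compact hull of a set: explicit form and API -/

/-- The **compact hull** of `K ⊆ X`: `K` together with those connected components of `X ∖ K`
whose closure is compact ("`K` with its relatively compact holes filled"; Phillips 1967, proof
of Lemma 1.1: "the union of `Mᵢ` and of the compact components of `M - Int Mᵢ`"). The set
produced by `exists_isCompact_superset_forall_not_isCompact_closure` is `compactHull K`.
[cite: Phillips1967, proof of Lemma 1.1 (p. 176)] -/
def compactHull (K : Set X) : Set X :=
  K ∪ ⋃ x ∈ {x | x ∉ K ∧ IsCompact (closure (connectedComponentIn Kᶜ x))},
    connectedComponentIn Kᶜ x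

/-- `K` lies in its compact hull. [folklore] -/
theorem subset_compactHull (K : Set X) : K ⊆ compactHull K := subset_union_left

/-- Membership in the filled part of the hull is a property of the component in `X ∖ K`.
[folklore] -/
theorem mem_compactHull_iff {K : Set X} {x : X} :
    x ∈ compactHull K ↔ x ∈ K ∨ (x ∉ K ∧ IsCompact (closure (connectedComponentIn Kᶜ x))) := by
  by_cases hxK : x ∈ K
  · simp only [hxK, true_or, iff_true]
    exact subset_compactHull K hxK
  simp only [compactHull, mem_union, hxK, false_or, mem_iUnion, mem_setOf_eq, exists_prop,
    not_false_eq_true, true_and]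
  constructor
  · rintro ⟨z, ⟨-, hz⟩, hxz⟩
    rwa [connectedComponentIn_eq hxz] at hz
  · intro hc
    exact ⟨x, ⟨hxK, hc⟩, mem_connectedComponentIn hxK⟩

/-- A point outside `K` whose component in `X ∖ K` has compact closure lies in the hull.
[folklore] -/
theorem mem_compactHull_of_isCompact_closure {K : Set X} {x : X} (hx : x ∉ K)
    (hc : IsCompact (closure (connectedComponentIn Kᶜ x))) : x ∈ compactHull K :=
  mem_compactHull_iff.2 (Or.inr ⟨hx, hc⟩)

/-- A component of `X ∖ K` with compact closure lies in the hull. [folklore] -/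
theorem connectedComponentIn_subset_compactHull {K : Set X} {x : X}
    (hc : IsCompact (closure (connectedComponentIn Kᶜ x))) :
    connectedComponentIn Kᶜ x ⊆ compactHull K := by
  intro y hy
  have hyK : y ∉ K := connectedComponentIn_subset _ _ hy
  refine mem_compactHull_of_isCompact_closure hyK ?_
  rwa [← connectedComponentIn_eq hy]

/-- **The complement of the hull** is the union of the components of `X ∖ K` whose closure is
not compact. [folklore] -/
theorem compl_compactHull_eq (K : Set X) :
    (compactHull K)ᶜ = ⋃ x ∈ {x | x ∉ K ∧ ¬ IsCompact (closure (connectedComponentIn Kᶜ x))},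
      connectedComponentIn Kᶜ x := by
  ext y
  simp only [mem_compl_iff, mem_compactHull_iff, not_or, not_and, mem_iUnion, mem_setOf_eq,
    exists_prop]
  constructor
  · rintro ⟨hyK, hyc⟩
    exact ⟨y, ⟨hyK, hyc hyK⟩, mem_connectedComponentIn hyK⟩
  · rintro ⟨x, ⟨-, hx⟩, hyx⟩
    have hyK : y ∉ K := connectedComponentIn_subset _ _ hyx
    exact ⟨hyK, fun _ => by rwa [← connectedComponentIn_eq hyx]⟩

/-- Outside the hull, the component in the complement of the hull **is** the component in
`X ∖ K` (which has non-compact closure). [folklore] -/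
theorem connectedComponentIn_compl_compactHull {K : Set X} {x : X} (hx : x ∉ compactHull K) :
    connectedComponentIn (compactHull K)ᶜ x = connectedComponentIn Kᶜ x := by
  have hxK : x ∉ K := fun h => hx (subset_compactHull K h)
  have hnc : ¬ IsCompact (closure (connectedComponentIn Kᶜ x)) := fun h =>
    hx (mem_compactHull_of_isCompact_closure hxK h)
  refine (connectedComponentIn_mono x (compl_subset_compl.2 (subset_compactHull K))).antisymm ?_
  refine isPreconnected_connectedComponentIn.subset_connectedComponentIn
    (mem_connectedComponentIn hxK) fun y hy hyH => ?_
  rcases mem_compactHull_iff.1 hyH with hyK | ⟨-, hyc⟩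
  · exact connectedComponentIn_subset _ _ hy hyK
  · rw [← connectedComponentIn_eq hy] at hyc
    exact hnc hyc

/-- **No component of the complement of the hull has compact closure.** [folklore] -/
theorem not_isCompact_closure_connectedComponentIn_compl_compactHull {K : Set X} {x : X}
    (hx : x ∉ compactHull K) :
    ¬ IsCompact (closure (connectedComponentIn (compactHull K)ᶜ x)) := by
  rw [connectedComponentIn_compl_compactHull hx]
  exact fun h =>
    hx (mem_compactHull_of_isCompact_closure (fun h' => hx (subset_compactHull K h')) h)

/-- The hull of a closed set in a locally connected space is closed (its complement is a
union of open components). [folklore] -/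
theorem isClosed_compactHull [LocallyConnectedSpace X] {K : Set X} (hK : IsClosed K) :
    IsClosed (compactHull K) := by
  rw [← isOpen_compl_iff, compl_compactHull_eq]
  exact isOpen_biUnion fun x _ => hK.isOpen_compl.connectedComponentIn

/-- In a space without compact components, a component of `X ∖ K` (`K` closed) with compact
closure is **not** closed in `X`: otherwise it would be clopen and compact and would contain
the component of any of its points. [folklore] -/
theorem not_isClosed_connectedComponentIn_compl [LocallyConnectedSpace X]
    (hopen : ∀ x : X, ¬ IsCompact (connectedComponent x)) {K : Set X} (hK : IsClosed K)
    {x : X} (hx : x ∉ K) (hc : IsCompact (closure (connectedComponentIn Kᶜ x))) :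
    ¬ IsClosed (connectedComponentIn Kᶜ x) := by
  intro hcl
  have hclopen : IsClopen (connectedComponentIn Kᶜ x) :=
    ⟨hcl, hK.isOpen_compl.connectedComponentIn⟩
  have hsub : connectedComponent x ⊆ connectedComponentIn Kᶜ x :=
    hclopen.connectedComponent_subset (mem_connectedComponentIn hx)
  exact hopen x (hc.of_isClosed_subset isClosed_connectedComponent (hsub.trans subset_closure))

/-- **The hull of a compact set is compact** (Hausdorff, weakly locally compact, locally
connected space without compact components): it is closed, and it lies in the union of a
compact neighbourhood `L` of `K` and of the finitely many relatively compact components of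
`X ∖ K` meeting `frontier L` — a relatively compact component missing `frontier L` lies in
`interior L`, as it cannot lie outside `closure L` (it would then be closed).
[cite: Phillips1967, proof of Lemma 1.1 (p. 176)] -/
theorem isCompact_compactHull [T2Space X] [WeaklyLocallyCompactSpace X] [LocallyConnectedSpace X]
    (hopen : ∀ x : X, ¬ IsCompact (connectedComponent x)) {K : Set X} (hK : IsCompact K) :
    IsCompact (compactHull K) := by
  classical
  set C : X → Set X := fun x => connectedComponentIn Kᶜ x with hC
  have hCo : ∀ x, IsOpen (C x) := fun x => hK.isClosed.isOpen_compl.connectedComponentIn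
  have hCeq : ∀ {a b : X}, b ∈ C a → C a = C b := fun h => connectedComponentIn_eq h
  obtain ⟨L, hL, hKL⟩ := exists_compact_superset hK
  have hfrK : frontier L ⊆ Kᶜ := fun y hy hyK => hy.2 (hKL hyK)
  have hfrc : IsCompact (frontier L) :=
    hL.of_isClosed_subset isClosed_frontier
      (frontier_subset_closure.trans hL.isClosed.closure_subset)
  obtain ⟨t, htcov⟩ : ∃ t : Finset X, frontier L ⊆ ⋃ x ∈ t, C x :=
    hfrc.elim_finite_subcover (fun x => C x) (fun x => hCo x) fun y hy =>
      mem_iUnion.2 ⟨y, mem_connectedComponentIn (hfrK hy)⟩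
  have hsub : compactHull K ⊆
      L ∪ ⋃ x ∈ (t.filter fun x => IsCompact (closure (C x))), closure (C x) := by
    intro y hy
    rcases mem_compactHull_iff.1 hy with hyK | ⟨hyK, hyc⟩
    · exact Or.inl (interior_subset (hKL hyK))
    by_cases hmeet : (C y ∩ frontier L).Nonempty
    · obtain ⟨w, hwC, hwfr⟩ := hmeet
      obtain ⟨x, hxt, hwx⟩ := mem_iUnion₂.1 (htcov hwfr)
      have hCx : C x = C y := by rw [hCeq hwx, ← hCeq hwC]
      refine Or.inr (mem_iUnion₂.2 ⟨x, ?_, ?_⟩)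
      · rw [Finset.mem_filter]; exact ⟨hxt, by rw [hCx]; exact hyc⟩
      · rw [hCx]; exact subset_closure (mem_connectedComponentIn hyK)
    · rw [not_nonempty_iff_eq_empty] at hmeet
      have hsplit : C y ⊆ interior L ∪ (closure L)ᶜ := by
        intro w hw
        by_contra hw'
        simp only [mem_union, mem_compl_iff, not_or, not_not] at hw'
        have : w ∈ C y ∩ frontier L := ⟨hw, hw'.2, hw'.1⟩
        rw [hmeet] at this
        exact this
      rcases isPreconnected_connectedComponentIn.subset_or_subset isOpen_interior
        isClosed_closure.isOpen_compl (disjoint_compl_right.mono_left interior_subset_closure)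
        hsplit with h | h
      · exact Or.inl (interior_subset (h (mem_connectedComponentIn hyK)))
      · exfalso
        refine not_isClosed_connectedComponentIn_compl hopen hK.isClosed hyK hyc
          (isClosed_connectedComponentIn_of_closure_subset ?_)
        intro w hw hwK
        have h1 : closure (C y) ⊆ closure ((closure L)ᶜ) := closure_mono h
        have h2 : closure ((closure L)ᶜ) ⊆ (interior L)ᶜ := by
          rw [closure_compl]
          exact compl_subset_compl.2 (interior_mono subset_closure)
        exact (h2 (h1 hw)) (hKL hwK)
  exact (hL.union ((t.filter fun x => IsCompact (closure (C x))).isCompact_biUnion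
    fun x hx => (Finset.mem_filter.1 hx).2)).of_isClosed_subset
    (isClosed_compactHull hK.isClosed) hsub

/-- **Hulls of nested sets are strictly nested**: if `K₁ ⊆ interior K₂` then
`compactHull K₁ ⊆ interior (compactHull K₂)` — a relatively compact component `D` of `X ∖ K₁`
is open and lies in the hull of `K₂`, every component of `X ∖ K₂` meeting `D` being contained
in `D`. (Phillips 1967, proof of Lemma 1.1: "`Mᵢ' ⊂ Int Mᵢ₊₁'`".)
[cite: Phillips1967, proof of Lemma 1.1 (p. 176)] -/
theorem compactHull_subset_interior_compactHull [LocallyConnectedSpace X] {K₁ K₂ : Set X}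
    (hK₁ : IsClosed K₁) (h : K₁ ⊆ interior K₂) :
    compactHull K₁ ⊆ interior (compactHull K₂) := by
  have h12 : K₁ ⊆ K₂ := h.trans interior_subset
  intro x hx
  rcases mem_compactHull_iff.1 hx with hxK | ⟨hxK, hxc⟩
  · exact interior_mono (subset_compactHull K₂) (h hxK)
  -- `x` lies in a relatively compact component `D` of `X ∖ K₁`, which is open and inside the hull
  set D : Set X := connectedComponentIn K₁ᶜ x with hD
  have hDo : IsOpen D := hK₁.isOpen_compl.connectedComponentIn
  have hDsub : D ⊆ compactHull K₂ := by
    intro y hy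
    by_cases hyK₂ : y ∈ K₂
    · exact subset_compactHull K₂ hyK₂
    refine mem_compactHull_of_isCompact_closure hyK₂ (hxc.of_isClosed_subset isClosed_closure
      (closure_mono ?_))
    -- the component of `y` in `X ∖ K₂` lies in `D`
    have hyD : connectedComponentIn K₂ᶜ y ⊆ connectedComponentIn K₁ᶜ y :=
      connectedComponentIn_mono y (compl_subset_compl.2 h12)
    rw [hD, connectedComponentIn_eq hy]
    exact hyD
  exact interior_maximal hDsub hDo (mem_connectedComponentIn hxK)

/-- The set of `exists_isCompact_superset_forall_not_isCompact_closure` may be taken to be the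
compact hull. [cite: Phillips1967, proof of Lemma 1.1 (p. 176)] -/
theorem compactHull_spec [T2Space X] [WeaklyLocallyCompactSpace X] [LocallyConnectedSpace X]
    (hopen : ∀ x : X, ¬ IsCompact (connectedComponent x)) {K : Set X} (hK : IsCompact K) :
    IsCompact (compactHull K) ∧ K ⊆ compactHull K ∧
      ∀ x, x ∉ compactHull K → ¬ IsCompact (closure (connectedComponentIn (compactHull K)ᶜ x)) :=
  ⟨isCompact_compactHull hopen hK, subset_compactHull K,
    fun _ hx => not_isCompact_closure_connectedComponentIn_compl_compactHull hx⟩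

end Literature.Topology
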